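import Summits.CriticalPhenomena.SAWScalingLimit.Theses.SAWLaplacianWalk

/-!
# Route SAWLaplacianWalk, support item `TipForgetsTarget` (stmt-CriticalPhenomena-4485): helpers

Deterministic facts about the slit masses
`Z_δ(w, S, c) = Σ_{ω : SAW of Ω_δ from w to c, tail ω ∩ S = ∅} x_c^{|ω|}`
(the `let Z` of `TipForgetsTarget`, `TipHarmonicLaw`, `SlitFirstStep`):

* `SAWLaplacianWalk.domainSAW_finite` — for bounded `Ω` and `δ > 0` the type of SAWs of `Ω_δ` between
  ANY two sites is finite (so every `Z` is a finite sum);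
* `SAWLaplacianWalk.slitMass_nonneg`, `SAWLaplacianWalk.slitMass_pos_of_mem_support` — `Z ≥ 0`, and
  along a SAW `γ` the mass from a vertex `w` of `γ` to the endpoint, avoiding the prefix
  `γ.takeUntil w`, is positive (the suffix `γ.dropUntil w` is admissible);
* `SAWLaplacianWalk.criticalFugacity_mul_slitMass_le` — one-step monotonicity
  `x_c · Z(w', S', c) ≤ Z(w, S, c)` for `w ∼ w'`, `w ∈ S'`, `w' ∉ S ⊆ S'` (prepend the step);
* `SAWLaplacianWalk.adj_and_support_takeUntil_of_length_succ` — two prefixes of a walk whose lengths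
  differ by one: the tips are adjacent and the supports differ by the new tip.

On the event of `TipForgetsTarget` these make all four masses positive (both logarithms are logarithms
of positive reals: the jump is the genuine one-step log-likelihood ratio of "aim at `d`" versus
"aim at `b`").
-/

namespace Summit.CriticalPhenomena.SAWScalingLimit.Theorems

open Literature.Probability.LatticeModels Literature.Probability.RandomPlanarGeometry

/-- Two prefixes `p.takeUntil w`, `p.takeUntil w'` of one walk whose lengths differ by one: the tips
are adjacent, `w ∼ w'`, and the longer support is the shorter one with `w'` appended. [folklore] -/
theorem SAWLaplacianWalk.adj_and_support_takeUntil_of_length_succ {V : Type*} [DecidableEq V]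
    {G : SimpleGraph V} {u v w w' : V} (p : G.Walk u v) (hw : w ∈ p.support) (hw' : w' ∈ p.support)
    (h : (p.takeUntil w' hw').length = (p.takeUntil w hw).length + 1) :
    G.Adj w w' ∧ (p.takeUntil w' hw').support = (p.takeUntil w hw).support ++ [w'] := by
  set n := (p.takeUntil w hw).length with hn
  have hle : n + 1 ≤ p.length := h ▸ p.length_takeUntil_le_length hw'
  have hwn : p.getVert n = w := p.getVert_length_takeUntil hw
  have hw'n : p.getVert (n + 1) = w' := h ▸ p.getVert_length_takeUntil hw'
  refine ⟨hwn ▸ hw'n ▸ p.adj_getVert_succ hle, ?_⟩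
  have h1 : (p.takeUntil w hw).support = p.support.take (n + 1) := by
    rw [p.takeUntil_eq_take hw, SimpleGraph.Walk.support_copy, SimpleGraph.Walk.support_take,
      ← p.length_takeUntil hw]
  have h2 : (p.takeUntil w' hw').support = p.support.take (n + 2) := by
    rw [p.takeUntil_eq_take hw', SimpleGraph.Walk.support_copy, SimpleGraph.Walk.support_take,
      ← p.length_takeUntil hw', h]
  have hlt : n + 1 < p.support.length := by
    rw [SimpleGraph.Walk.length_support]; omega
  rw [h1, h2, List.take_add_one, List.getElem?_eq_getElem hlt]
  simp only [Option.toList_some, List.append_cancel_left_eq, List.cons.injEq, and_true]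
  rw [← hw'n, p.getVert_eq_support_getElem hle]

variable {Ω : Set ℂ} {δ : ℝ}

/-- For a bounded domain and `δ > 0`, the self-avoiding walks of `Ω_δ` between any two sites form a
finite type: a walk of `Ω_δ` from `u` stays in the finite set `meshDomain Ω δ ∪ {u}` and a path is
determined by its (duplicate-free) vertex list. [folklore] -/
theorem SAWLaplacianWalk.domainSAW_finite (hΩ : Bornology.IsBounded Ω) (hδ : 0 < δ) (u v : Site 2) :
    Finite (SAW.DomainSAW Ω δ u v) := by
  classical
  let S : Set (Site 2) := meshDomain Ω δ ∪ {u}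
  have hSfin : S.Finite := (meshDomain_finite hΩ hδ).union (Set.finite_singleton _)
  haveI : Fintype ↥S := hSfin.fintype
  have hsupp : ∀ γ : SAW.DomainSAW Ω δ u v, ∀ w ∈ γ.walk.support, w ∈ S := by
    intro γ
    have key : ∀ {x y : Site 2} (p : (discreteDomainGraph Ω δ).Walk x y),
        x ∈ S → ∀ w ∈ p.support, w ∈ S := by
      intro x y p
      induction p with
      | nil =>
        intro hx w hw
        rw [SimpleGraph.Walk.support_nil, List.mem_singleton] at hw
        exact hw ▸ hx
      | cons h p ih =>
        intro hx w hw
        rw [SimpleGraph.Walk.support_cons, List.mem_cons] at hw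
        rcases hw with rfl | hw
        · exact hx
        · exact ih (Or.inl (discreteDomainGraph_adj_iff.1 h).2.2) w hw
    exact key γ.walk (Or.inr rfl)
  let F : SAW.DomainSAW Ω δ u v → {l : List ↥S // l.length ≤ Fintype.card ↥S} :=
    fun γ => ⟨γ.walk.support.pmap (fun w hw => ⟨w, hw⟩) (hsupp γ), by
      rw [List.length_pmap]
      have hnd : (γ.walk.support.pmap (fun w hw => (⟨w, hw⟩ : ↥S)) (hsupp γ)).Nodup :=
        List.Nodup.pmap (fun _ _ _ _ h => congrArg Subtype.val h) γ.isPath.support_nodup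
      have := hnd.length_le_card
      rwa [List.length_pmap] at this⟩
  haveI : Finite {l : List ↥S // l.length ≤ Fintype.card ↥S} :=
    (List.finite_length_le _ _).to_subtype
  refine Finite.of_injective F fun γ γ' h => ?_
  have h' := congrArg (fun l : {l : List ↥S // l.length ≤ Fintype.card ↥S} => l.1.map Subtype.val) h
  obtain ⟨p, hp⟩ := γ
  obtain ⟨p', hp'⟩ := γ'
  have hs : p.support = p'.support := by simpa [F, List.map_pmap] using h'
  cases SimpleGraph.Walk.support_injective hs
  rfl

/-- The slit mass `Z_δ(w, S, c)` is non-negative (`x_c > 0`). [folklore] -/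
theorem SAWLaplacianWalk.slitMass_nonneg (w c : Site 2) (S : List (Site 2)) :
    0 ≤ ∑' ω : SAW.DomainSAW Ω δ w c,
      (if ∀ v ∈ ω.walk.support.tail, v ∉ S then SAW.criticalFugacity ^ ω.length else 0) := by
  refine tsum_nonneg fun ω => ?_
  split_ifs
  · exact pow_nonneg SAW.criticalFugacity_pos_lt_one'.1.le _
  · exact le_rfl

/-- Along a SAW `γ` of `Ω_δ` (bounded `Ω`, `δ > 0`) the slit mass from any vertex `w` of `γ` to the
endpoint of `γ`, avoiding the prefix `γ.takeUntil w`, is positive: the suffix `γ.dropUntil w` is a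
self-avoiding walk whose tail misses the prefix, of weight `x_c^{|suffix|} > 0`. In `TipForgetsTarget`
this is `0 < Z_δ(w, supp η_w, b_δ)` for every prefix tip `w`. [folklore] -/
theorem SAWLaplacianWalk.slitMass_pos_of_mem_support (hΩ : Bornology.IsBounded Ω) (hδ : 0 < δ)
    {u c : Site 2} (γ : SAW.DomainSAW Ω δ u c) {w : Site 2} (hw : w ∈ γ.walk.support) :
    0 < ∑' ω : SAW.DomainSAW Ω δ w c,
      (if ∀ v ∈ ω.walk.support.tail, v ∉ (γ.walk.takeUntil w hw).support
        then SAW.criticalFugacity ^ ω.length else 0) := by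
  classical
  haveI : Finite (SAW.DomainSAW Ω δ w c) := SAWLaplacianWalk.domainSAW_finite hΩ hδ w c
  haveI : Fintype (SAW.DomainSAW Ω δ w c) := Fintype.ofFinite _
  rw [tsum_fintype]
  let ω₀ : SAW.DomainSAW Ω δ w c := ⟨γ.walk.dropUntil w hw, γ.isPath.dropUntil hw⟩
  have hgood : ∀ v ∈ ω₀.walk.support.tail, v ∉ (γ.walk.takeUntil w hw).support := by
    intro v hv hv'
    have hnd : ((γ.walk.takeUntil w hw).support ++ (γ.walk.dropUntil w hw).support.tail).Nodup := by
      rw [← SimpleGraph.Walk.support_append, SimpleGraph.Walk.take_spec]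
      exact γ.isPath.support_nodup
    exact List.disjoint_of_nodup_append hnd hv' hv
  have hterm : (0 : ℝ) < (if ∀ v ∈ ω₀.walk.support.tail, v ∉ (γ.walk.takeUntil w hw).support
      then SAW.criticalFugacity ^ ω₀.length else 0) := by
    rw [if_pos hgood]
    exact pow_pos SAW.criticalFugacity_pos_lt_one'.1 _
  set f : SAW.DomainSAW Ω δ w c → ℝ := fun ω =>
    if ∀ v ∈ ω.walk.support.tail, v ∉ (γ.walk.takeUntil w hw).support
      then SAW.criticalFugacity ^ ω.length else 0 with hf
  have hnn : ∀ ω ∈ (Finset.univ : Finset (SAW.DomainSAW Ω δ w c)), 0 ≤ f ω := by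
    intro ω _
    simp only [hf]
    split_ifs
    · exact pow_nonneg SAW.criticalFugacity_pos_lt_one'.1.le _
    · exact le_rfl
  exact lt_of_lt_of_le hterm (Finset.single_le_sum hnn (Finset.mem_univ ω₀))

/-- One-step monotonicity of slit masses: if `w ∼ w'` in `Ω_δ`, `w ∈ S'`, `w' ∉ S` and `S ⊆ S'`, then
`x_c · Z_δ(w', S', c) ≤ Z_δ(w, S, c)` — prepend the step `w → w'` to every admissible SAW from `w'`
(it stays self-avoiding because its tail misses `S' ∋ w`). In `TipForgetsTarget` (with `S, S'` the
supports of consecutive prefixes) this gives `0 < Z_δ(w, supp η_w, d_δ)` from the conjunct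
`0 < Z_δ(w', supp η_{w'}, d_δ)`; it is one inequality of the first-step decomposition
`SlitFirstStep`. [folklore] -/
theorem SAWLaplacianWalk.criticalFugacity_mul_slitMass_le (hΩ : Bornology.IsBounded Ω) (hδ : 0 < δ)
    {w w' c : Site 2} {S S' : List (Site 2)} (hadj : (discreteDomainGraph Ω δ).Adj w w')
    (hwS' : w ∈ S') (hw'S : w' ∉ S) (hSS' : S ⊆ S') :
    SAW.criticalFugacity * ∑' ω : SAW.DomainSAW Ω δ w' c,
        (if ∀ v ∈ ω.walk.support.tail, v ∉ S' then SAW.criticalFugacity ^ ω.length else 0)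
      ≤ ∑' ω : SAW.DomainSAW Ω δ w c,
        (if ∀ v ∈ ω.walk.support.tail, v ∉ S then SAW.criticalFugacity ^ ω.length else 0) := by
  classical
  haveI : Finite (SAW.DomainSAW Ω δ w c) := SAWLaplacianWalk.domainSAW_finite hΩ hδ w c
  haveI : Finite (SAW.DomainSAW Ω δ w' c) := SAWLaplacianWalk.domainSAW_finite hΩ hδ w' c
  haveI : Fintype (SAW.DomainSAW Ω δ w c) := Fintype.ofFinite _
  haveI : Fintype (SAW.DomainSAW Ω δ w' c) := Fintype.ofFinite _
  rw [tsum_fintype, tsum_fintype, Finset.mul_sum]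
  set f : SAW.DomainSAW Ω δ w c → ℝ := fun ω =>
    if ∀ v ∈ ω.walk.support.tail, v ∉ S then SAW.criticalFugacity ^ ω.length else 0 with hf
  have hfnn : ∀ ω, 0 ≤ f ω := fun ω => by
    simp only [hf]
    split_ifs
    · exact pow_nonneg SAW.criticalFugacity_pos_lt_one'.1.le _
    · exact le_rfl
  -- the admissible walks from `w'` miss `w`
  have hmiss : ∀ ω : SAW.DomainSAW Ω δ w' c, (∀ v ∈ ω.walk.support.tail, v ∉ S') →
      w ∉ ω.walk.support := by
    intro ω hω hmem
    rw [← SimpleGraph.Walk.cons_tail_support, List.mem_cons] at hmem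
    rcases hmem with h | h
    · exact hadj.ne h
    · exact hω w h hwS'
  -- prepend the step `w → w'` (junk branch, never used: the suffix from `w`)
  let e : SAW.DomainSAW Ω δ w' c → SAW.DomainSAW Ω δ w c := fun ω =>
    if h : w ∈ ω.walk.support then ⟨ω.walk.dropUntil w h, ω.isPath.dropUntil h⟩
    else ⟨SimpleGraph.Walk.cons hadj ω.walk,
      (SimpleGraph.Walk.cons_isPath_iff hadj ω.walk).2 ⟨ω.isPath, h⟩⟩
  have he : ∀ ω : SAW.DomainSAW Ω δ w' c, (∀ v ∈ ω.walk.support.tail, v ∉ S') →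
      (e ω).walk = SimpleGraph.Walk.cons hadj ω.walk := by
    intro ω hω
    simp only [e, dif_neg (hmiss ω hω)]
  have hinj : Set.InjOn e ↑((Finset.univ : Finset (SAW.DomainSAW Ω δ w' c)).filter
      fun ω => ∀ v ∈ ω.walk.support.tail, v ∉ S') := by
    intro ω₁ h₁ ω₂ h₂ h12
    have h₁' : ∀ v ∈ ω₁.walk.support.tail, v ∉ S' := (Finset.mem_filter.1 h₁).2
    have h₂' : ∀ v ∈ ω₂.walk.support.tail, v ∉ S' := (Finset.mem_filter.1 h₂).2
    have h12' := congrArg SAW.DomainSAW.walk h12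
    rw [he ω₁ h₁', he ω₂ h₂'] at h12'
    have h12'' : ω₁.walk = ω₂.walk := by
      simpa only [SimpleGraph.Walk.cons.injEq, heq_eq_eq, true_and] using h12'
    obtain ⟨p₁, hp₁⟩ := ω₁
    obtain ⟨p₂, hp₂⟩ := ω₂
    cases h12''
    rfl
  -- value of `f` on a prepended walk
  have hfe : ∀ ω : SAW.DomainSAW Ω δ w' c, (∀ v ∈ ω.walk.support.tail, v ∉ S') →
      f (e ω) = SAW.criticalFugacity ^ (ω.length + 1) := by
    intro ω hω
    have hgood : ∀ v ∈ (e ω).walk.support.tail, v ∉ S := by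
      rw [he ω hω, SimpleGraph.Walk.support_cons, List.tail_cons]
      intro v hv
      rw [← SimpleGraph.Walk.cons_tail_support, List.mem_cons] at hv
      rcases hv with rfl | hv
      · exact hw'S
      · exact fun hS => hω v hv (hSS' hS)
    have hlen : (e ω).length = ω.length + 1 := by
      change (e ω).walk.length = ω.walk.length + 1
      rw [he ω hω, SimpleGraph.Walk.length_cons]
    simp only [hf]
    rw [if_pos hgood, hlen]
  calc ∑ ω : SAW.DomainSAW Ω δ w' c, SAW.criticalFugacity *
          (if ∀ v ∈ ω.walk.support.tail, v ∉ S' then SAW.criticalFugacity ^ ω.length else 0)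
        = ∑ ω ∈ (Finset.univ : Finset (SAW.DomainSAW Ω δ w' c)).filter
            (fun ω => ∀ v ∈ ω.walk.support.tail, v ∉ S'), f (e ω) := by
          rw [Finset.sum_filter]
          refine Finset.sum_congr rfl fun ω _ => ?_
          split_ifs with hω
          · rw [hfe ω hω, pow_succ, mul_comm]
          · rw [mul_zero]
    _ = ∑ ω' ∈ ((Finset.univ : Finset (SAW.DomainSAW Ω δ w' c)).filter
            (fun ω => ∀ v ∈ ω.walk.support.tail, v ∉ S')).image e, f ω' :=
          (Finset.sum_image hinj).symm
    _ ≤ ∑ ω' : SAW.DomainSAW Ω δ w c, f ω' :=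
          Finset.sum_le_sum_of_subset_of_nonneg (Finset.subset_univ _) fun ω' _ _ => hfnn ω'

/-- **The four slit masses on the event of `TipForgetsTarget` are positive.** For a SAW `γ` of `Ω_δ`
(bounded `Ω`, `δ > 0`) from `u` to `b'`, two prefix tips `w`, `w'` with
`|γ.takeUntil w'| = |γ.takeUntil w| + 1`, and a target `d'` with `0 < Z_δ(w', supp (γ.takeUntil w'), d')`:
the tips are adjacent and `Z_δ(w, supp (γ.takeUntil w), b') > 0`, `Z_δ(w', supp (γ.takeUntil w'), b') > 0`,
`Z_δ(w, supp (γ.takeUntil w), d') > 0`. Hence in `TipForgetsTarget` both `Real.log` terms are logarithms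
of positive reals and the jump `log M_{η'} − log M_η` is the genuine one-step log-likelihood ratio
`log (P^{d}(w → w' | η)/P^{b}(w → w' | η))` of the SAW aimed at `d_δ` versus aimed at `b_δ`. [folklore] -/
theorem SAWLaplacianWalk.slitMasses_pos_of_step (hΩ : Bornology.IsBounded Ω) (hδ : 0 < δ)
    {u b' d' : Site 2} (γ : SAW.DomainSAW Ω δ u b') {w w' : Site 2} (hw : w ∈ γ.walk.support)
    (hw' : w' ∈ γ.walk.support)
    (hlen : (γ.walk.takeUntil w' hw').length = (γ.walk.takeUntil w hw).length + 1)
    (hd : 0 < ∑' ω : SAW.DomainSAW Ω δ w' d',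
      (if ∀ v ∈ ω.walk.support.tail, v ∉ (γ.walk.takeUntil w' hw').support
        then SAW.criticalFugacity ^ ω.length else 0)) :
    (discreteDomainGraph Ω δ).Adj w w' ∧
    (0 < ∑' ω : SAW.DomainSAW Ω δ w b',
      (if ∀ v ∈ ω.walk.support.tail, v ∉ (γ.walk.takeUntil w hw).support
        then SAW.criticalFugacity ^ ω.length else 0)) ∧
    (0 < ∑' ω : SAW.DomainSAW Ω δ w' b',
      (if ∀ v ∈ ω.walk.support.tail, v ∉ (γ.walk.takeUntil w' hw').support
        then SAW.criticalFugacity ^ ω.length else 0)) ∧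
    (0 < ∑' ω : SAW.DomainSAW Ω δ w d',
      (if ∀ v ∈ ω.walk.support.tail, v ∉ (γ.walk.takeUntil w hw).support
        then SAW.criticalFugacity ^ ω.length else 0)) := by
  classical
  obtain ⟨hadj, hsupp⟩ :=
    SAWLaplacianWalk.adj_and_support_takeUntil_of_length_succ γ.walk hw hw' hlen
  refine ⟨hadj, SAWLaplacianWalk.slitMass_pos_of_mem_support hΩ hδ γ hw,
    SAWLaplacianWalk.slitMass_pos_of_mem_support hΩ hδ γ hw', ?_⟩
  -- `w ∈ S'`, `w' ∉ S`, `S ⊆ S'` for the consecutive prefix supports `S`, `S' = S ++ [w']`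
  have hwS' : w ∈ (γ.walk.takeUntil w' hw').support :=
    hsupp ▸ List.mem_append_left _ (SimpleGraph.Walk.end_mem_support _)
  have hw'S : w' ∉ (γ.walk.takeUntil w hw).support := by
    intro hmem
    have hnd : ((γ.walk.takeUntil w hw).support ++ [w']).Nodup :=
      hsupp ▸ (γ.isPath.takeUntil hw').support_nodup
    exact List.disjoint_of_nodup_append hnd hmem (List.mem_singleton_self _)
  have hSS' : (γ.walk.takeUntil w hw).support ⊆ (γ.walk.takeUntil w' hw').support :=
    hsupp ▸ List.subset_append_left _ _
  have hle := SAWLaplacianWalk.criticalFugacity_mul_slitMass_le (c := d') hΩ hδ hadj hwS' hw'S hSS'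
  exact lt_of_lt_of_le (mul_pos SAW.criticalFugacity_pos_lt_one'.1 hd) hle

end Summit.CriticalPhenomena.SAWScalingLimit.Theorems
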